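import Mathlib.AlgebraicTopology.FundamentalGroupoid.SimplyConnected
import Mathlib.Analysis.Convex.Contractible
import Mathlib.Topology.Homotopy.Product
import Mathlib.Topology.Homeomorph.Lemmas
import Literature.AlgebraicTopology.FundamentalGroup.SphereSimplyConnected
import Literature.Geometry.Lorentzian.KerrDataProofs
import Literature.Geometry.Lorentzian.KerrConvergence
import HarnessLib

/-!
# Kerr–Schild chart blocks are simply connected, and the closed ones are compact

(namespace `Literature.Geometry.Lorentzian`, sub-namespace `Kerr` for the Kerr–Schild part; uses
`Kerr.radius`, `Kerr.rPlus` (`KerrSchild.lean`), `Kerr.radius_spheroidal`,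
`Kerr.continuous_spheroidal` (`KerrDataProofs.lean`), `poincareInv`, `boostedKerrBackground`,
`ModelBackground.truncLateRegion`, `Spacetime.IsLateChart` (`KerrConvergence.lean`).)

The time–radius blocks of the Kerr–Schild chart, `{x ∈ E4 | (x⁰, r(a, x)) ∈ S}` for a set
`S ⊆ ℝ × (0, ∞)` of admissible (time, radius) pairs, are homeomorphic to `S × S²`: the oblate
spheroidal coordinates `x ↦ ((x⁰, r), ω)`, `ω = (x¹/√(r² + a²), x²/√(r² + a²), x³/r)` (a unit
vector by the defining quartic `r⁴ − (|x⃗|² − a²) r² − a² (x³)² = 0`), with inverse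
`((t, r), ω) ↦ (t, √(r² + a²) ω₁, √(r² + a²) ω₂, r ω₃)` (O'Neill 1995, Ch. 2 §2.1: the level sets
`{r = c}` are the confocal ellipsoids `(x² + y²)/(c² + a²) + z²/c² = 1`). Consequences:

* `Kerr.simplyConnectedSpace_timeRadius` — for `S` convex and nonempty the block is simply
  connected (`S` is contractible, `S²` is simply connected: Hatcher 2002, Prop. 1.14, the tree's
  `simplyConnectedSpace_sphere`; products: Hatcher 2002, Prop. 1.12);
* `Kerr.isCompact_timeRadius` — for `S` compact the block is compact;
* the same for the boosted, translated blocks `{x | ((Λ⁻¹(x − c))⁰, r(a, Λ⁻¹(x − c))) ∈ S}` of the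
  backgrounds `boostedKerrBackground Λ c M a` of an `N`-black-hole final state decomposition
  (`poincareInv Λ c` is a homeomorphism of `E4`), in particular for the truncated world-tubes
  `truncLateRegion τ₁ R = {τ₁ < t*, r ≤ R}` of `FinalStateDecomposition.exists_pairwise_disjoint`
  and for the closed blocks `{τ₁ ≤ t* ≤ τ₂, r₁ ≤ r ≤ R}`;
* `Spacetime.IsLateChart.isEmbedding_restrict` — a late-time chart restricted to any subset of its
  late region is an embedding (so chart images of the blocks are embedded simply connected sets,
  compact for the closed blocks).

Everything is proved; no definitions, no named facts.

## References

* B. O'Neill, *The geometry of Kerr black holes*, A K Peters 1995, Ch. 2 §2.1 (Kerr–Schild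
  ellipsoids `{r = c}`; Boyer–Lindquist blocks `ℝ × (r₊, ∞) × S²`). [ONeill1995]
* A. Hatcher, *Algebraic Topology*, CUP 2002, Prop. 1.12 (`π₁` of a product), Prop. 1.14
  (`π₁(Sⁿ) = 0`, `n ≥ 2`). [HatcherAT2002]
* M. Visser, arXiv:0706.0622, (35) (the Kerr–Schild radius quartic). [arXiv07060622]
-/

noncomputable section

open Set Metric Topology

namespace Literature.Geometry.Lorentzian

/-- A product of simply connected spaces is simply connected (private copy of the folklore lemma
of `AFEndFarLoops.lean` / `GluckTwistSimplyConnected.lean`, outside this file's import cone).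
Hatcher 2002, Prop. 1.12. [cite: HatcherAT2002, Prop. 1.12] -/
private theorem simplyConnectedSpace_prod_aux {α β : Type*} [TopologicalSpace α]
    [TopologicalSpace β] [SimplyConnectedSpace α] [SimplyConnectedSpace β] :
    SimplyConnectedSpace (α × β) := by
  rw [simply_connected_iff_paths_homotopic]
  refine ⟨inferInstance, ?_⟩
  rintro ⟨a₁, b₁⟩ ⟨a₂, b₂⟩
  refine ⟨fun p q => ?_⟩
  rw [← Path.Homotopic.prod_projLeft_projRight p, ← Path.Homotopic.prod_projLeft_projRight q,
    Subsingleton.elim (Path.Homotopic.projLeft p) (Path.Homotopic.projLeft q),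
    Subsingleton.elim (Path.Homotopic.projRight p) (Path.Homotopic.projRight q)]

/-- `(t, y) ↦ (t, y) ∈ E4` is jointly continuous (private copy of
`E4.continuous_ofTimeSpace_uncurry` of `KerrSchildEnergyEstimate.lean`, outside this file's
import cone). [folklore] -/
private theorem continuous_ofTimeSpace_uncurry_aux :
    Continuous fun q : ℝ × E3 ↦ E4.ofTimeSpace q.1 q.2 := by
  unfold E4.ofTimeSpace
  refine (PiLp.continuous_toLp 2 _).comp (continuous_pi fun i ↦ ?_)
  refine Fin.cases ?_ (fun j ↦ ?_) i
  · simp only [Matrix.cons_val_zero]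
    exact continuous_fst
  · simp only [Matrix.cons_val_succ]
    exact (continuous_apply j).comp ((PiLp.continuous_ofLp 2 _).comp continuous_snd)

namespace Kerr

/-! ### Oblate spheroidal coordinates on `E4` -/

/-- The squared spatial norm in coordinates: `|x⃗|² = (x¹)² + (x²)² + (x³)²`. [folklore] -/
private theorem spatialNorm_sq_eq (x : E4) :
    E4.spatialNorm x ^ 2 = x 1 ^ 2 + x 2 ^ 2 + x 3 ^ 2 := by
  rw [E4.spatialNorm, EuclideanSpace.real_norm_sq_eq, Fin.sum_univ_three]
  rfl

/-- **The oblate direction is a unit vector**: for `r = r(a, x) > 0`,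
`ω(x) = (x¹/√(r² + a²), x²/√(r² + a²), x³/r)` has `‖ω(x)‖ = 1` — this is the defining quartic
`r⁴ − (|x⃗|² − a²) r² − a² (x³)² = 0` divided by `r² (r² + a²)`. O'Neill 1995, Ch. 2 §2.1;
Visser arXiv:0706.0622, (35). [cite: ONeill1995, Ch. 2 §2.1] -/
private theorem norm_oblateDir_eq_one {a : ℝ} {x : E4} (hr : 0 < radius a x) :
    ‖(WithLp.toLp 2 ![x 1 / √(radius a x ^ 2 + a ^ 2), x 2 / √(radius a x ^ 2 + a ^ 2),
      x 3 / radius a x] : E3)‖ = 1 := by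
  set r := radius a x with hrdef
  have hra : 0 < r ^ 2 + a ^ 2 := by positivity
  have hcsq : √(r ^ 2 + a ^ 2) ^ 2 = r ^ 2 + a ^ 2 := Real.sq_sqrt hra.le
  have hc0 : 0 < √(r ^ 2 + a ^ 2) := Real.sqrt_pos.2 hra
  have hq : r ^ 4 - (x 1 ^ 2 + x 2 ^ 2 + x 3 ^ 2 - a ^ 2) * r ^ 2 - a ^ 2 * x 3 ^ 2 = 0 := by
    have h := radius_quartic a x
    rwa [spatialNorm_sq_eq] at h
  rw [EuclideanSpace.norm_eq, Real.sqrt_eq_one, Fin.sum_univ_three]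
  simp only [Matrix.cons_val_zero, Matrix.cons_val_one, Matrix.cons_val, Real.norm_eq_abs,
    sq_abs]
  rw [div_pow, div_pow, div_pow, hcsq]
  field_simp
  linear_combination (-1 : ℝ) * hq

/-- The oblate spheroidal point of the direction `ω(x)` at radius `r(a, x)` is the spatial part of
`x`: `(√(r² + a²) ω₁, √(r² + a²) ω₂, r ω₃) = x⃗`. O'Neill 1995, Ch. 2 §2.1. [cite: ONeill1995, Ch. 2 §2.1] -/
private theorem spheroidal_oblateDir {a : ℝ} {x : E4} (hr : 0 < radius a x) :
    (WithLp.toLp 2 ![√(radius a x ^ 2 + a ^ 2) * (x 1 / √(radius a x ^ 2 + a ^ 2)),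
      √(radius a x ^ 2 + a ^ 2) * (x 2 / √(radius a x ^ 2 + a ^ 2)),
      radius a x * (x 3 / radius a x)] : E3) = E4.spatial x := by
  have hc0 : 0 < √(radius a x ^ 2 + a ^ 2) := Real.sqrt_pos.2 (by positivity)
  ext i
  fin_cases i
  · simp only [Fin.zero_eta, Fin.isValue, Matrix.cons_val_zero, E4.spatial_apply]
    rw [mul_div_cancel₀ _ hc0.ne']
    rfl
  · simp only [Fin.mk_one, Fin.isValue, Matrix.cons_val_one, Matrix.cons_val_zero,
      E4.spatial_apply]
    rw [mul_div_cancel₀ _ hc0.ne']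
    rfl
  · simp only [Fin.reduceFinMk, Matrix.cons_val, E4.spatial_apply]
    rw [mul_div_cancel₀ _ hr.ne']
    rfl

/-- The Kerr–Schild radius does not depend on the time coordinate: `r(a, (t, y)) = r(a, (0, y))`
(it is a function of `|y|` and `y₃` only). Visser arXiv:0706.0622, (35). [cite: arXiv07060622, (35)] -/
private theorem radius_ofTimeSpace_eq (a t : ℝ) (y : E3) :
    radius a (E4.ofTimeSpace t y) = radius a (E4.ofTimeSpace 0 y) := by
  have h3 : ∀ s : ℝ, (E4.ofTimeSpace s y : E4) 3 = y 2 := fun s ↦ E4.ofTimeSpace_apply_succ s y 2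
  unfold radius
  rw [E4.spatialNorm_ofTimeSpace, E4.spatialNorm_ofTimeSpace, h3 t, h3 0]

/-- The Kerr–Schild radius of `(t, √(r² + a²) ω₁, √(r² + a²) ω₂, r ω₃)` is `r`, for every time `t`
(`r > 0`, `‖ω‖ = 1`): `Kerr.radius_spheroidal` and time-independence of `r(a, ·)`.
O'Neill 1995, Ch. 2 §2.1. [cite: ONeill1995, Ch. 2 §2.1] -/
private theorem radius_ofTimeSpace_spheroidal {a r : ℝ} (t : ℝ) (hr : 0 < r) {ω : E3}
    (hω : ‖ω‖ = 1) :
    radius a (E4.ofTimeSpace t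
      (WithLp.toLp 2 ![√(r ^ 2 + a ^ 2) * ω 0, √(r ^ 2 + a ^ 2) * ω 1, r * ω 2])) = r := by
  rw [radius_ofTimeSpace_eq]
  exact radius_spheroidal hr hω

/-- **Oblate spheroidal coordinates on a time–radius block.** For `S ⊆ ℝ × (0, ∞)` the block
`{x ∈ E4 | (x⁰, r(a, x)) ∈ S}` is homeomorphic to `S × S²`, by a homeomorphism whose first
component is `x ↦ (x⁰, r(a, x))` (the second is the oblate direction
`(x¹/√(r² + a²), x²/√(r² + a²), x³/r)`; the inverse is
`((t, r), ω) ↦ (t, √(r² + a²) ω₁, √(r² + a²) ω₂, r ω₃)`). O'Neill 1995, Ch. 2 §2.1 (the level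
sets `{r = c}`, `c > 0`, are the ellipsoids `(x² + y²)/(c² + a²) + z²/c² = 1`). [cite: ONeill1995, Ch. 2 §2.1] -/
theorem exists_homeomorph_timeRadius (a : ℝ) {S : Set (ℝ × ℝ)} (hpos : ∀ p ∈ S, 0 < p.2) :
    ∃ e : {x : E4 // (x 0, radius a x) ∈ S} ≃ₜ S × sphere (0 : E3) 1,
      ∀ x, ((e x).1 : ℝ × ℝ) = ((x : E4) 0, radius a (x : E4)) := by
  -- positivity on the block
  have hr : ∀ x : {x : E4 // (x 0, radius a x) ∈ S}, 0 < radius a (x : E4) :=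
    fun x ↦ hpos _ x.2
  have hc : ∀ x : {x : E4 // (x 0, radius a x) ∈ S}, 0 < √(radius a (x : E4) ^ 2 + a ^ 2) :=
    fun x ↦ Real.sqrt_pos.2 (by have := hr x; positivity)
  -- the spheroidal point of a parameter `((t, r), ω)` lies in the block
  have hmem : ∀ p : S × sphere (0 : E3) 1,
      ((E4.ofTimeSpace (p.1 : ℝ × ℝ).1 (WithLp.toLp 2
        ![√((p.1 : ℝ × ℝ).2 ^ 2 + a ^ 2) * (p.2 : E3) 0,
          √((p.1 : ℝ × ℝ).2 ^ 2 + a ^ 2) * (p.2 : E3) 1, (p.1 : ℝ × ℝ).2 * (p.2 : E3) 2])) 0,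
        radius a (E4.ofTimeSpace (p.1 : ℝ × ℝ).1 (WithLp.toLp 2
          ![√((p.1 : ℝ × ℝ).2 ^ 2 + a ^ 2) * (p.2 : E3) 0,
            √((p.1 : ℝ × ℝ).2 ^ 2 + a ^ 2) * (p.2 : E3) 1,
            (p.1 : ℝ × ℝ).2 * (p.2 : E3) 2]))) ∈ S := by
    rintro ⟨⟨⟨t, r⟩, htr⟩, ⟨ω, hω⟩⟩
    have hω' : ‖ω‖ = 1 := by rwa [mem_sphere_zero_iff_norm] at hω
    simp only [E4.ofTimeSpace_apply_zero]
    rw [radius_ofTimeSpace_spheroidal t (hpos _ htr) hω']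
    exact htr
  refine ⟨{ toFun := fun x ↦ (⟨((x : E4) 0, radius a (x : E4)), x.2⟩,
              ⟨WithLp.toLp 2 ![(x : E4) 1 / √(radius a (x : E4) ^ 2 + a ^ 2),
                (x : E4) 2 / √(radius a (x : E4) ^ 2 + a ^ 2), (x : E4) 3 / radius a (x : E4)],
                by rw [mem_sphere_zero_iff_norm]; exact norm_oblateDir_eq_one (hr x)⟩)
            invFun := fun p ↦ ⟨E4.ofTimeSpace (p.1 : ℝ × ℝ).1 (WithLp.toLp 2
              ![√((p.1 : ℝ × ℝ).2 ^ 2 + a ^ 2) * (p.2 : E3) 0,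
                √((p.1 : ℝ × ℝ).2 ^ 2 + a ^ 2) * (p.2 : E3) 1, (p.1 : ℝ × ℝ).2 * (p.2 : E3) 2]),
              hmem p⟩
            left_inv := fun x ↦ by
              apply Subtype.ext
              simp only [Matrix.cons_val_zero, Matrix.cons_val_one, Matrix.cons_val]
              rw [spheroidal_oblateDir (hr x)]
              exact E4.ofTimeSpace_time_spatial (x : E4)
            right_inv := fun p ↦ by
              obtain ⟨⟨⟨t, r⟩, htr⟩, ⟨ω, hω⟩⟩ := p
              have hr0 : 0 < r := hpos _ htr
              have hω' : ‖ω‖ = 1 := by rwa [mem_sphere_zero_iff_norm] at hω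
              have hrad := radius_ofTimeSpace_spheroidal (a := a) t hr0 hω'
              have hc0 : 0 < √(r ^ 2 + a ^ 2) := Real.sqrt_pos.2 (by positivity)
              refine Prod.ext (Subtype.ext ?_) (Subtype.ext ?_)
              · simp only [E4.ofTimeSpace_apply_zero]
                rw [hrad]
              · simp only
                rw [hrad]
                ext i
                fin_cases i
                · simp only [Fin.zero_eta, Fin.isValue, Matrix.cons_val_zero]
                  rw [show (E4.ofTimeSpace t (WithLp.toLp 2 ![√(r ^ 2 + a ^ 2) * ω 0,
                      √(r ^ 2 + a ^ 2) * ω 1, r * ω 2]) : E4) 1 = √(r ^ 2 + a ^ 2) * ω 0 from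
                    E4.ofTimeSpace_apply_succ t _ 0]
                  field_simp
                · simp only [Fin.mk_one, Fin.isValue, Matrix.cons_val_one, Matrix.cons_val_zero]
                  rw [show (E4.ofTimeSpace t (WithLp.toLp 2 ![√(r ^ 2 + a ^ 2) * ω 0,
                      √(r ^ 2 + a ^ 2) * ω 1, r * ω 2]) : E4) 2 = √(r ^ 2 + a ^ 2) * ω 1 from
                    E4.ofTimeSpace_apply_succ t _ 1]
                  field_simp
                · simp only [Fin.reduceFinMk, Matrix.cons_val]
                  rw [show (E4.ofTimeSpace t (WithLp.toLp 2 ![√(r ^ 2 + a ^ 2) * ω 0,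
                      √(r ^ 2 + a ^ 2) * ω 1, r * ω 2]) : E4) 3 = r * ω 2 from
                    E4.ofTimeSpace_apply_succ t _ 2]
                  field_simp
            continuous_toFun := by
              refine Continuous.prodMk (Continuous.subtype_mk ?_ _) (Continuous.subtype_mk ?_ _)
              · exact ((PiLp.continuous_apply 2 _ 0).comp continuous_subtype_val).prodMk
                  ((continuous_radius a).comp continuous_subtype_val)
              · have hR : Continuous fun x : {x : E4 // (x 0, radius a x) ∈ S} ↦
                    radius a (x : E4) := (continuous_radius a).comp continuous_subtype_val
                have hC : Continuous fun x : {x : E4 // (x 0, radius a x) ∈ S} ↦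
                    √(radius a (x : E4) ^ 2 + a ^ 2) := ((hR.pow 2).add continuous_const).sqrt
                have hco : ∀ i : Fin 4, Continuous fun x : {x : E4 // (x 0, radius a x) ∈ S} ↦
                    (x : E4) i := fun i ↦ (PiLp.continuous_apply 2 _ i).comp continuous_subtype_val
                refine (PiLp.continuous_toLp 2 _).comp (continuous_pi fun i ↦ ?_)
                fin_cases i
                · simp only [Fin.zero_eta, Fin.isValue, Matrix.cons_val_zero]
                  exact (hco 1).div hC fun x ↦ (hc x).ne'
                · simp only [Fin.mk_one, Fin.isValue, Matrix.cons_val_one, Matrix.cons_val_zero]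
                  exact (hco 2).div hC fun x ↦ (hc x).ne'
                · simp only [Fin.reduceFinMk, Matrix.cons_val]
                  exact (hco 3).div hR fun x ↦ (hr x).ne'
            continuous_invFun := by
              refine Continuous.subtype_mk ?_ _
              refine continuous_ofTimeSpace_uncurry_aux.comp (Continuous.prodMk ?_ ?_)
              · exact continuous_fst.comp (continuous_subtype_val.comp continuous_fst)
              · exact (continuous_spheroidal a).comp
                  ((continuous_snd.comp (continuous_subtype_val.comp continuous_fst)).prodMk
                    (continuous_subtype_val.comp continuous_snd)) }, fun x ↦ rfl⟩

/-- **Time–radius blocks of the Kerr–Schild chart are simply connected**: for `S ⊆ ℝ × (0, ∞)`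
convex and nonempty, `{x ∈ E4 | (x⁰, r(a, x)) ∈ S} ≅ S × S²` with `S` contractible and `S²`
simply connected. O'Neill 1995, Ch. 2 §2.1; Hatcher 2002, Prop. 1.12 and Prop. 1.14. [cite: HatcherAT2002, Prop. 1.14] -/
theorem simplyConnectedSpace_timeRadius (a : ℝ) {S : Set (ℝ × ℝ)} (hS : Convex ℝ S)
    (hne : S.Nonempty) (hpos : ∀ p ∈ S, 0 < p.2) :
    SimplyConnectedSpace {x : E4 // (x 0, radius a x) ∈ S} := by
  haveI : Fact (Module.finrank ℝ E3 = 2 + 1) := ⟨by simp⟩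
  haveI : SimplyConnectedSpace (sphere (0 : E3) 1) :=
    Literature.AlgebraicTopology.FundamentalGroup.simplyConnectedSpace_sphere le_rfl
  haveI : ContractibleSpace S := hS.contractibleSpace hne
  haveI : SimplyConnectedSpace (S × sphere (0 : E3) 1) := simplyConnectedSpace_prod_aux
  obtain ⟨e, -⟩ := exists_homeomorph_timeRadius a hpos
  exact e.toHomotopyEquiv.simplyConnectedSpace_iff.2 inferInstance

/-- **Closed time–radius blocks of the Kerr–Schild chart are compact**: for `S ⊆ ℝ × (0, ∞)`
compact, `{x ∈ E4 | (x⁰, r(a, x)) ∈ S} ≅ S × S²` is compact. O'Neill 1995, Ch. 2 §2.1. [cite: ONeill1995, Ch. 2 §2.1] -/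
theorem isCompact_timeRadius (a : ℝ) {S : Set (ℝ × ℝ)} (hS : IsCompact S)
    (hpos : ∀ p ∈ S, 0 < p.2) : IsCompact {x : E4 | (x 0, radius a x) ∈ S} := by
  haveI : CompactSpace S := isCompact_iff_compactSpace.1 hS
  obtain ⟨e, -⟩ := exists_homeomorph_timeRadius a hpos
  haveI : CompactSpace {x : E4 // (x 0, radius a x) ∈ S} := e.symm.compactSpace
  exact isCompact_iff_compactSpace.2 this

/-! ### Boosted, translated blocks -/

/-- The inverse Poincaré map `x ↦ Λ⁻¹(x − c)` is a homeomorphism of `E4` (inverse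
`y ↦ Λ y + c`). O'Neill 1983, Ch. 9, p. 236. [cite: ONeill1983, Ch. 9 p. 236] -/
theorem exists_homeomorph_poincareInv (Λ : lorentzGroup) (c : E4) :
    ∃ e : E4 ≃ₜ E4, ⇑e = poincareInv Λ c :=
  ⟨{ toFun := poincareInv Λ c
     invFun := fun y ↦ (Λ : E4 ≃L[ℝ] E4) y + c
     left_inv := fun x ↦ by simp [poincareInv]
     right_inv := fun y ↦ by simp [poincareInv]
     continuous_toFun := continuous_poincareInv Λ c
     continuous_invFun := ((Λ : E4 ≃L[ℝ] E4).continuous).add continuous_const }, rfl⟩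

/-- **Boosted time–radius blocks are simply connected**: `{x ∈ E4 | ((Λ⁻¹(x − c))⁰,
r(a, Λ⁻¹(x − c))) ∈ S}` is the preimage of the block of `simplyConnectedSpace_timeRadius` under
the homeomorphism `x ↦ Λ⁻¹(x − c)`. (`S ⊆ ℝ × (0, ∞)` convex, nonempty.) O'Neill 1995, Ch. 2 §2.1;
Hatcher 2002, Prop. 1.14. [cite: HatcherAT2002, Prop. 1.14] -/
theorem simplyConnectedSpace_timeRadius_poincareInv (Λ : lorentzGroup) (c : E4) (a : ℝ)
    {S : Set (ℝ × ℝ)} (hS : Convex ℝ S) (hne : S.Nonempty) (hpos : ∀ p ∈ S, 0 < p.2) :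
    SimplyConnectedSpace
      {x : E4 // (poincareInv Λ c x 0, radius a (poincareInv Λ c x)) ∈ S} := by
  haveI := simplyConnectedSpace_timeRadius a hS hne hpos
  obtain ⟨e, he⟩ := exists_homeomorph_poincareInv Λ c
  let e' : {x : E4 // (poincareInv Λ c x 0, radius a (poincareInv Λ c x)) ∈ S} ≃ₜ
      {x : E4 // (x 0, radius a x) ∈ S} :=
    e.subtype (p := fun x : E4 ↦ (poincareInv Λ c x 0, radius a (poincareInv Λ c x)) ∈ S)
      (q := fun x : E4 ↦ (x 0, radius a x) ∈ S) fun x ↦ by rw [he]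
  exact e'.toHomotopyEquiv.simplyConnectedSpace_iff.2 inferInstance

/-- **Boosted closed time–radius blocks are compact** (`S ⊆ ℝ × (0, ∞)` compact): preimage of the
compact block of `isCompact_timeRadius` under the homeomorphism `x ↦ Λ⁻¹(x − c)`.
O'Neill 1995, Ch. 2 §2.1. [cite: ONeill1995, Ch. 2 §2.1] -/
theorem isCompact_timeRadius_poincareInv (Λ : lorentzGroup) (c : E4) (a : ℝ)
    {S : Set (ℝ × ℝ)} (hS : IsCompact S) (hpos : ∀ p ∈ S, 0 < p.2) :
    IsCompact {x : E4 | (poincareInv Λ c x 0, radius a (poincareInv Λ c x)) ∈ S} := by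
  obtain ⟨e, he⟩ := exists_homeomorph_poincareInv Λ c
  have h := (e.isCompact_preimage (s := {x : E4 | (x 0, radius a x) ∈ S})).2
    (isCompact_timeRadius a hS hpos)
  rwa [he] at h

end Kerr

/-! ### Blocks of the boosted Kerr backgrounds of a final state decomposition -/

/-- A block of the domain `boostedKerrExterior Λ c M a`, cut out by a condition on (time, radius)
that forces `r > max r₊ 0`, is homeomorphic to the same block cut out of `E4` (the membership in
the exterior being automatic). [folklore] -/
private theorem exists_homeomorph_domainBlock (Λ : lorentzGroup) (c : E4) (M a : ℝ)
    {S : Set (ℝ × ℝ)} (hpos : ∀ p ∈ S, max (Kerr.rPlus M a) 0 < p.2) :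
    Nonempty ({x : (boostedKerrBackground Λ c M a).domain //
        ((boostedKerrBackground Λ c M a).time (x : E4), (boostedKerrBackground Λ c M a).radius (x : E4)) ∈ S} ≃ₜ
      {x : E4 // (poincareInv Λ c x 0, Kerr.radius a (poincareInv Λ c x)) ∈ S}) := by
  -- membership in the boosted exterior is `max r₊ 0 < r(a, Λ⁻¹(y − c))`
  have hmem : ∀ y : {x : E4 // (poincareInv Λ c x 0, Kerr.radius a (poincareInv Λ c x)) ∈ S},
      (y : E4) ∈ (boostedKerrBackground Λ c M a).domain := fun y ↦
    show poincareInv Λ c (y : E4) ∈ (Kerr.exterior M a : Set E4) from hpos _ y.2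
  exact ⟨{ toFun := fun x ↦ ⟨(x.1 : E4), x.2⟩
           invFun := fun y ↦ ⟨⟨(y : E4), hmem y⟩, y.2⟩
           left_inv := fun x ↦ rfl
           right_inv := fun y ↦ rfl
           continuous_toFun :=
             (continuous_subtype_val.comp continuous_subtype_val).subtype_mk _
           continuous_invFun := (continuous_subtype_val.subtype_mk _).subtype_mk _ }⟩

/-- **Blocks of a boosted Kerr background are simply connected**: for `S ⊆ ℝ × (max r₊ 0, ∞)`
convex and nonempty, the block `{x ∈ boostedKerrExterior Λ c M a | (t*(x), r(x)) ∈ S}` of the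
background `boostedKerrBackground Λ c M a` (time `t* = (Λ⁻¹(x − c))⁰`, radius
`r = r(a, Λ⁻¹(x − c))`) is simply connected. O'Neill 1995, Ch. 2 §2.1; Hatcher 2002, Prop. 1.14. [cite: HatcherAT2002, Prop. 1.14] -/
theorem boostedKerrBackground_simplyConnectedSpace_block (Λ : lorentzGroup) (c : E4) (M a : ℝ)
    {S : Set (ℝ × ℝ)} (hS : Convex ℝ S) (hne : S.Nonempty)
    (hpos : ∀ p ∈ S, max (Kerr.rPlus M a) 0 < p.2) :
    SimplyConnectedSpace {x : (boostedKerrBackground Λ c M a).domain //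
      ((boostedKerrBackground Λ c M a).time (x : E4), (boostedKerrBackground Λ c M a).radius (x : E4)) ∈ S} := by
  have hpos' : ∀ p ∈ S, 0 < p.2 := fun p hp ↦ (le_max_right _ _).trans_lt (hpos p hp)
  haveI := Kerr.simplyConnectedSpace_timeRadius_poincareInv Λ c a hS hne hpos'
  obtain ⟨e⟩ := exists_homeomorph_domainBlock Λ c M a hpos
  exact e.toHomotopyEquiv.simplyConnectedSpace_iff.2 inferInstance

/-- **Closed blocks of a boosted Kerr background are compact**: for `S ⊆ ℝ × (max r₊ 0, ∞)`
compact, the block `{x ∈ boostedKerrExterior Λ c M a | (t*(x), r(x)) ∈ S}` is a compact subset of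
the domain. O'Neill 1995, Ch. 2 §2.1. [cite: ONeill1995, Ch. 2 §2.1] -/
theorem boostedKerrBackground_isCompact_block (Λ : lorentzGroup) (c : E4) (M a : ℝ)
    {S : Set (ℝ × ℝ)} (hS : IsCompact S) (hpos : ∀ p ∈ S, max (Kerr.rPlus M a) 0 < p.2) :
    IsCompact {x : (boostedKerrBackground Λ c M a).domain |
      ((boostedKerrBackground Λ c M a).time (x : E4), (boostedKerrBackground Λ c M a).radius (x : E4)) ∈ S} := by
  have hpos' : ∀ p ∈ S, 0 < p.2 := fun p hp ↦ (le_max_right _ _).trans_lt (hpos p hp)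
  have hK := Kerr.isCompact_timeRadius_poincareInv Λ c a hS hpos'
  haveI : CompactSpace {x : E4 // (poincareInv Λ c x 0, Kerr.radius a (poincareInv Λ c x)) ∈ S} :=
    isCompact_iff_compactSpace.1 hK
  obtain ⟨e⟩ := exists_homeomorph_domainBlock Λ c M a hpos
  haveI := e.symm.compactSpace
  exact isCompact_iff_compactSpace.2 this

/-- **The truncated late world-tubes are simply connected**: the set
`truncLateRegion τ₁ R = {τ₁ < t*, r ≤ R}` of the boosted Kerr background (the world-tubes of
`FinalStateDecomposition.exists_pairwise_disjoint`), as a space, is simply connected as soon as it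
is nonempty (`max r₊ 0 < R`): it is the block over the convex set `(τ₁, ∞) × (max r₊ 0, R]`.
O'Neill 1995, Ch. 2 §2.1; Hatcher 2002, Prop. 1.14. [cite: HatcherAT2002, Prop. 1.14] -/
theorem boostedKerrBackground_simplyConnectedSpace_truncLateRegion (Λ : lorentzGroup) (c : E4)
    {M a R : ℝ} (τ₁ : ℝ) (hR : max (Kerr.rPlus M a) 0 < R) :
    SimplyConnectedSpace ((boostedKerrBackground Λ c M a).truncLateRegion τ₁ R) := by
  set B := boostedKerrBackground Λ c M a with hB
  have hS : Convex ℝ (Ioi τ₁ ×ˢ Ioc (max (Kerr.rPlus M a) 0) R) := (convex_Ioi τ₁).prod (convex_Ioc _ _)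
  have hne : (Ioi τ₁ ×ˢ Ioc (max (Kerr.rPlus M a) 0) R).Nonempty :=
    ⟨(τ₁ + 1, R), lt_add_one τ₁, hR, le_rfl⟩
  haveI := boostedKerrBackground_simplyConnectedSpace_block Λ c M a hS hne
    (fun p hp ↦ hp.2.1)
  -- the truncated late region IS that block (membership in the exterior gives `max r₊ 0 < r`)
  let e : (B.truncLateRegion τ₁ R) ≃ₜ {x : B.domain //
      (B.time (x : E4), B.radius (x : E4)) ∈ Ioi τ₁ ×ˢ Ioc (max (Kerr.rPlus M a) 0) R} :=
    { toFun := fun x ↦ ⟨x.1, (ModelBackground.mem_truncLateRegion.1 x.2).1, x.1.2,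
        (ModelBackground.mem_truncLateRegion.1 x.2).2⟩
      invFun := fun x ↦ ⟨x.1, ModelBackground.mem_truncLateRegion.2 ⟨x.2.1, x.2.2.2⟩⟩
      left_inv := fun _ ↦ rfl
      right_inv := fun _ ↦ rfl
      continuous_toFun := continuous_subtype_val.subtype_mk _
      continuous_invFun := continuous_subtype_val.subtype_mk _ }
  exact e.toHomotopyEquiv.simplyConnectedSpace_iff.2 inferInstance

/-- **The closed chart blocks `{τ₁ ≤ t* ≤ τ₂, r₁ ≤ r ≤ R}` are simply connected**
(`max r₊ 0 < r₁ ≤ R`, `τ₁ ≤ τ₂`): the block over the convex set `[τ₁, τ₂] × [r₁, R]`.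
O'Neill 1995, Ch. 2 §2.1; Hatcher 2002, Prop. 1.14. [cite: HatcherAT2002, Prop. 1.14] -/
theorem boostedKerrBackground_simplyConnectedSpace_closedBlock (Λ : lorentzGroup) (c : E4)
    {M a τ₁ τ₂ r₁ R : ℝ} (hτ : τ₁ ≤ τ₂) (hr₁ : max (Kerr.rPlus M a) 0 < r₁) (hR : r₁ ≤ R) :
    SimplyConnectedSpace {x : (boostedKerrBackground Λ c M a).domain //
      ((boostedKerrBackground Λ c M a).time (x : E4), (boostedKerrBackground Λ c M a).radius (x : E4)) ∈
        Icc τ₁ τ₂ ×ˢ Icc r₁ R} :=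
  boostedKerrBackground_simplyConnectedSpace_block Λ c M a ((convex_Icc τ₁ τ₂).prod (convex_Icc r₁ R))
    ⟨(τ₁, r₁), ⟨le_rfl, hτ⟩, ⟨le_rfl, hR⟩⟩ fun _ hp ↦ hr₁.trans_le hp.2.1

/-- **The closed chart blocks `{τ₁ ≤ t* ≤ τ₂, r₁ ≤ r ≤ R}` are compact** (`max r₊ 0 < r₁`), as
subsets of the chart domain; hence their images under a (continuous) late-time chart are compact,
and closed in a Hausdorff spacetime. O'Neill 1995, Ch. 2 §2.1. [cite: ONeill1995, Ch. 2 §2.1] -/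
theorem boostedKerrBackground_isCompact_closedBlock (Λ : lorentzGroup) (c : E4)
    {M a r₁ : ℝ} (τ₁ τ₂ R : ℝ) (hr₁ : max (Kerr.rPlus M a) 0 < r₁) :
    IsCompact {x : (boostedKerrBackground Λ c M a).domain |
      ((boostedKerrBackground Λ c M a).time (x : E4), (boostedKerrBackground Λ c M a).radius (x : E4)) ∈
        Icc τ₁ τ₂ ×ˢ Icc r₁ R} :=
  boostedKerrBackground_isCompact_block Λ c M a (isCompact_Icc.prod isCompact_Icc)
    fun _ hp ↦ hr₁.trans_le hp.2.1

/-! ### Late-time charts embed every subset of the late region -/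

namespace Spacetime

universe u

variable {𝓢 : Spacetime.{u} 4} {B : ModelBackground} {𝒟 : Set 𝓢.carrier} {τ₀ : ℝ}
  {Ψ : B.domain → 𝓢.carrier}

/-- **A late-time chart restricted to any subset of its late region is an embedding** (the
restriction of the open embedding `(lateRegion τ₀).restrict Ψ` along the inclusion `s ↪ lateRegion τ₀`).
With the blocks above: the chart images of the truncated world-tubes / closed blocks after time
`τ₀` are embedded simply connected subsets of the spacetime (compact for the closed blocks).
DHRT arXiv:2104.08222, §1. [cite: arXiv210408222, §1] -/
theorem IsLateChart.isEmbedding_restrict (hΨ : 𝓢.IsLateChart B 𝒟 τ₀ Ψ) {s : Set B.domain}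
    (hs : s ⊆ B.lateRegion τ₀) : IsEmbedding (s.restrict Ψ) := by
  have h : s.restrict Ψ = (B.lateRegion τ₀).restrict Ψ ∘ Set.inclusion hs := by
    funext x
    rfl
  rw [h]
  exact hΨ.isOpenEmbedding.isEmbedding.comp (IsEmbedding.inclusion hs)

/-- The image of a compact block under a late-time chart is compact, hence closed
(`𝓢.carrier` is Hausdorff). [folklore] -/
theorem IsLateChart.isClosed_image (hΨ : 𝓢.IsLateChart B 𝒟 τ₀ Ψ) {s : Set B.domain}
    (hs : IsCompact s) : IsClosed (Ψ '' s) :=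
  (hs.image hΨ.contMDiff.continuous).isClosed

end Spacetime

end Literature.Geometry.Lorentzian
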